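import Literature.Probability.LatticeModels.IsingLimitLawTilt
import Literature.Probability.LatticeModels.IsingLimitLawLaplace
import HarnessLib

/-!
# Ising limit laws are closed under ferromagnetic Gaussian tilts `e^{cu²}`, `c ≥ 0`

Trunk T-STATMECH (`Literature/Probability/LatticeModels`), companion of `IsingLimitLaw.lean` and
`IsingLimitLawTilt.lean` (route RiemannHypothesis/LeeYang: "X ⇒ e^{cu²}ν_Φ/Z is an Ising limit law
for every c ≥ 0"; two-layer plan S1; the tower class — closure of the two-point laws under products
and forward heat flow — sits inside `IsIsingLimitLaw` by this file and `IsingLimitLawConv.lean`).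

* `tendsto_integral_of_tendsto_of_exp_mul_sq_bound` — weak convergence with a uniform bound on
  `∫ e^{(c+1)u²}` integrates continuous test functions of Gaussian growth `|g| ≤ K e^{cu²}`
  (truncation; the tails are `≤ K e^{-R²} ∫ e^{(c+1)u²}` uniformly).
* `IsIsingLimitLaw.gaussTilt` — if `ν` is an Ising limit law and `c ≥ 0` then so is the tilted law
  `ν' = e^{cu²}ν / ∫ e^{cu²} dν`: at the finite level the tilt is the RANK-ONE ferromagnetic coupling
  shift `J ↦ J + c w ⊗ w` (`integral_isingMagnetizationLaw_add_rankOne`, Simon–Griffiths' Curie–Weiss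
  term), the tilted finite laws converge weakly to `ν'` by the lemma above, and their
  Gaussian-exponential moments are `∫ e^{(b+c)u²} / ∫ e^{cu²} ≤ C_{b+c}`.

## References

* C. M. Newman, Proc. AMS 61 (1976), §1 (Gaussian tilts `e^{bt²}` of Lee–Yang measures);
  CPAM 27 (1974) 143–159, §1.
* B. Simon, R. B. Griffiths, CMP 33 (1973) 145–164, §II (Curie–Weiss couplings as `M²` terms).
* E. H. Lieb, A. D. Sokal, CMP 80 (1981) 153–179, §2 (closure properties).
-/

noncomputable section

open MeasureTheory Filter Topology
open scoped BigOperators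

namespace Literature.Probability.LatticeModels

/-! ### Test functions of Gaussian growth -/

/-- Tail estimate: for `R < |u|`, `e^{cu²} ≤ e^{-R²} e^{(c+1)u²}`. [folklore] -/
theorem exp_mul_sq_le_of_lt {c R u : ℝ} (hu : R < |u|) (hR : 0 ≤ R) :
    Real.exp (c * u ^ 2) ≤ Real.exp (-R ^ 2) * Real.exp ((c + 1) * u ^ 2) := by
  rw [← Real.exp_add]
  refine Real.exp_le_exp.2 ?_
  have h1 : R ^ 2 ≤ u ^ 2 := by
    rw [← sq_abs u]; exact pow_le_pow_left₀ hR hu.le 2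
  nlinarith

/-- **Weak convergence with Gaussian-exponential moment control integrates test functions of
Gaussian growth**: if `ν_k → ν` weakly, `∫ e^{(c+1)u²} dν_k ≤ C` and `g` is continuous with
`|g(u)| ≤ K e^{cu²}` (`c, K ≥ 0`), then `∫ g dν_k → ∫ g dν`. [Newman 1974, proof of Thm. 3] [folklore] -/
theorem tendsto_integral_of_tendsto_of_exp_mul_sq_bound {νs : ℕ → ProbabilityMeasure ℝ}
    {ν : ProbabilityMeasure ℝ} (hlim : Tendsto νs atTop (𝓝 ν)) {c C K : ℝ} (hc : 0 ≤ c)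
    (hK : 0 ≤ K)
    (hint : ∀ k, Integrable (fun u => Real.exp ((c + 1) * u ^ 2)) (νs k : Measure ℝ))
    (hC : ∀ k, ∫ u, Real.exp ((c + 1) * u ^ 2) ∂(νs k : Measure ℝ) ≤ C)
    {g : ℝ → ℝ} (hg : Continuous g) (hgK : ∀ u, |g u| ≤ K * Real.exp (c * u ^ 2)) :
    Tendsto (fun k => ∫ u, g u ∂(νs k : Measure ℝ)) atTop (𝓝 (∫ u, g u ∂(ν : Measure ℝ))) := by
  -- moment bound and integrability for the limit
  obtain ⟨hIν, hCν⟩ := integrable_exp_mul_sq_of_tendsto hlim hint hC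
  have hCpos : 0 < C := by
    have h1 : (1 : ℝ) ≤ ∫ u, Real.exp ((c + 1) * u ^ 2) ∂(νs 0 : Measure ℝ) := by
      have := integral_mono (integrable_const (1 : ℝ)) (hint 0)
        (fun u => by simpa using Real.one_le_exp (by positivity : 0 ≤ (c + 1) * u ^ 2))
      simpa using this
    linarith [hC 0]
  -- domination `|g| ≤ K e^{(c+1)u²}` and integrability of `g`
  have hexp_le : ∀ u : ℝ, Real.exp (c * u ^ 2) ≤ Real.exp ((c + 1) * u ^ 2) := fun u =>
    Real.exp_le_exp.2 (by nlinarith [sq_nonneg u])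
  have hdom : ∀ u, ‖g u‖ ≤ K * Real.exp ((c + 1) * u ^ 2) := fun u => by
    rw [Real.norm_eq_abs]; exact (hgK u).trans (mul_le_mul_of_nonneg_left (hexp_le u) hK)
  have hgν : Integrable g (ν : Measure ℝ) :=
    (hIν.const_mul _).mono' hg.aestronglyMeasurable (Eventually.of_forall hdom)
  have hgk : ∀ k, Integrable g (νs k : Measure ℝ) := fun k =>
    ((hint k).const_mul _).mono' hg.aestronglyMeasurable (Eventually.of_forall hdom)
  refine Metric.tendsto_atTop.2 fun ε hε => ?_
  -- choice of the truncation radius: `K e^{-R²} C ≤ ε/3`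
  set Lg : ℝ := max 0 (Real.log (3 * (K + 1) * C / ε)) with hLg
  set R : ℝ := Lg + 1 with hR
  have hLg0 : 0 ≤ Lg := le_max_left _ _
  have hR0 : 0 ≤ R := by rw [hR]; linarith
  have hR1 : 1 ≤ R := by rw [hR]; linarith
  have htail : K * (Real.exp (-R ^ 2) * C) ≤ ε / 3 := by
    have h1 : Lg ≤ R ^ 2 := by nlinarith
    have h2 : Real.exp (-R ^ 2) ≤ Real.exp (-Lg) := Real.exp_le_exp.2 (by linarith)
    have h3 : Real.exp (-Lg) ≤ ε / (3 * (K + 1) * C) := by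
      have : Real.log (3 * (K + 1) * C / ε) ≤ Lg := le_max_right _ _
      calc Real.exp (-Lg) ≤ Real.exp (-Real.log (3 * (K + 1) * C / ε)) :=
            Real.exp_le_exp.2 (neg_le_neg this)
        _ = (3 * (K + 1) * C / ε)⁻¹ := by rw [Real.exp_neg, Real.exp_log (by positivity)]
        _ = ε / (3 * (K + 1) * C) := by rw [inv_div]
    calc K * (Real.exp (-R ^ 2) * C) ≤ K * (ε / (3 * (K + 1) * C) * C) := by
          gcongr; exact h2.trans h3
      _ = ε / 3 * (K / (K + 1)) := by field_simp
      _ ≤ ε / 3 * 1 := by gcongr; rw [div_le_one (by linarith)]; linarith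
      _ = ε / 3 := mul_one _
  -- the cutoff and the truncated test function
  set χ : ℝ → ℝ := fun u => max 0 (min 1 (R + 1 - |u|)) with hχ
  have hχc : Continuous χ :=
    continuous_const.max (continuous_const.min (continuous_const.sub continuous_abs))
  have hχ0 : ∀ u, 0 ≤ χ u := fun u => le_max_left _ _
  have hχ1 : ∀ u, χ u ≤ 1 := fun u => max_le zero_le_one (min_le_left _ _)
  have hχR : ∀ u, |u| ≤ R → χ u = 1 := fun u hu => by
    rw [hχ]; dsimp only; rw [min_eq_left (by linarith), max_eq_right zero_le_one]
  have hχR' : ∀ u, R + 1 ≤ |u| → χ u = 0 := fun u hu => by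
    rw [hχ]; dsimp only; rw [max_eq_left]; exact min_le_of_right_le (by linarith)
  have hbound : ∀ u, ‖χ u * g u‖ ≤ K * Real.exp (c * (R + 1) ^ 2) := by
    intro u
    rw [norm_mul, Real.norm_of_nonneg (hχ0 u), Real.norm_eq_abs]
    rcases le_or_gt (|u|) (R + 1) with hu | hu
    · calc χ u * |g u| ≤ 1 * (K * Real.exp (c * u ^ 2)) :=
            mul_le_mul (hχ1 u) (hgK u) (abs_nonneg _) zero_le_one
        _ ≤ K * Real.exp (c * (R + 1) ^ 2) := by
            rw [one_mul]
            refine mul_le_mul_of_nonneg_left (Real.exp_le_exp.2 ?_) hK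
            refine mul_le_mul_of_nonneg_left ?_ hc
            rw [← sq_abs u]
            exact pow_le_pow_left₀ (abs_nonneg u) hu 2
    · rw [hχR' u hu.le, zero_mul]; positivity
  set f : BoundedContinuousFunction ℝ ℝ := BoundedContinuousFunction.ofNormedAddCommGroup
    (fun u => χ u * g u) (hχc.mul hg) _ hbound with hf
  have hfapply : ∀ u, f u = χ u * g u := fun u => rfl
  -- weak convergence on the truncated part
  have hweak := (ProbabilityMeasure.tendsto_iff_forall_integral_tendsto).1 hlim f
  obtain ⟨N, hN⟩ := Metric.tendsto_atTop.1 hweak (ε / 3) (by positivity)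
  refine ⟨N, fun k hk => ?_⟩
  -- tail control, uniformly in the measure
  have htailμ : ∀ (μ : Measure ℝ) [IsProbabilityMeasure μ],
      Integrable (fun u => Real.exp ((c + 1) * u ^ 2)) μ →
      Integrable g μ → ∫ u, Real.exp ((c + 1) * u ^ 2) ∂μ ≤ C →
        ‖∫ u, (g u - f u) ∂μ‖ ≤ ε / 3 := by
    intro μ _ hIμ hgμ hCμ
    have hpt : ∀ u, ‖g u - f u‖ ≤ K * (Real.exp (-R ^ 2) * Real.exp ((c + 1) * u ^ 2)) := by
      intro u
      have : g u - f u = (1 - χ u) * g u := by rw [hfapply]; ring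
      rw [this, norm_mul, Real.norm_of_nonneg (by linarith [hχ1 u]), Real.norm_eq_abs]
      rcases le_or_gt (|u|) R with hu | hu
      · rw [hχR u hu, sub_self, zero_mul]; positivity
      · calc (1 - χ u) * |g u| ≤ 1 * (K * Real.exp (c * u ^ 2)) :=
              mul_le_mul (by linarith [hχ0 u]) (hgK u) (abs_nonneg _) zero_le_one
          _ ≤ K * (Real.exp (-R ^ 2) * Real.exp ((c + 1) * u ^ 2)) := by
              rw [one_mul]; exact mul_le_mul_of_nonneg_left (exp_mul_sq_le_of_lt hu hR0) hK
    calc ‖∫ u, (g u - f u) ∂μ‖ ≤ ∫ u, ‖g u - f u‖ ∂μ := norm_integral_le_integral_norm _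
      _ ≤ ∫ u, K * (Real.exp (-R ^ 2) * Real.exp ((c + 1) * u ^ 2)) ∂μ :=
          integral_mono (hgμ.sub (f.integrable μ)).norm ((hIμ.const_mul _).const_mul _) hpt
      _ = K * (Real.exp (-R ^ 2) * ∫ u, Real.exp ((c + 1) * u ^ 2) ∂μ) := by
          rw [integral_const_mul, integral_const_mul]
      _ ≤ K * (Real.exp (-R ^ 2) * C) := by gcongr
      _ ≤ ε / 3 := htail
  have hsplit : ∀ (μ : Measure ℝ) [IsProbabilityMeasure μ], Integrable g μ →
      ∫ u, g u ∂μ = ∫ u, f u ∂μ + ∫ u, (g u - f u) ∂μ := by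
    intro μ _ hgμ
    have h1 : ∫ u, g u ∂μ = ∫ u, (f u + (g - ⇑f) u) ∂μ :=
      integral_congr_ae (Eventually.of_forall fun u => by simp)
    rw [h1, integral_add (f.integrable μ) (hgμ.sub (f.integrable μ))]
    simp only [Pi.sub_apply]
  rw [dist_eq_norm, hsplit _ (hgk k), hsplit _ hgν]
  have hk' := hN k hk
  rw [dist_eq_norm] at hk'
  calc ‖∫ u, f u ∂(νs k : Measure ℝ) + ∫ u, (g u - f u) ∂(νs k : Measure ℝ) -
        (∫ u, f u ∂(ν : Measure ℝ) + ∫ u, (g u - f u) ∂(ν : Measure ℝ))‖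
      = ‖(∫ u, f u ∂(νs k : Measure ℝ) - ∫ u, f u ∂(ν : Measure ℝ)) +
          ∫ u, (g u - f u) ∂(νs k : Measure ℝ) - ∫ u, (g u - f u) ∂(ν : Measure ℝ)‖ := by
        congr 1; abel
    _ ≤ ‖∫ u, f u ∂(νs k : Measure ℝ) - ∫ u, f u ∂(ν : Measure ℝ)‖ +
          ‖∫ u, (g u - f u) ∂(νs k : Measure ℝ)‖ + ‖∫ u, (g u - f u) ∂(ν : Measure ℝ)‖ :=
        norm_sub_le_of_le (norm_add_le _ _) le_rfl
    _ < ε / 3 + ε / 3 + ε / 3 := by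
        have h1 := htailμ (νs k : Measure ℝ) (hint k) (hgk k) (hC k)
        have h2 := htailμ (ν : Measure ℝ) hIν hgν hCν
        linarith
    _ = ε := by ring

/-! ### Closure of the class under Gaussian tilts -/

/-- **Ising limit laws are closed under ferromagnetic Gaussian tilts**: if `ν` is an Ising limit
law and `c ≥ 0`, then `ν' = e^{cu²} ν / ∫ e^{cu²} dν` is an Ising limit law. Finite level: the tilt is
the rank-one coupling shift `J ↦ J + c w ⊗ w ≥ 0` (`integral_isingMagnetizationLaw_add_rankOne`);
limit level: `tendsto_integral_of_tendsto_of_exp_mul_sq_bound`; moments: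
`∫ e^{bu²} dν'_k = ∫ e^{(b+c)u²} dν_k / ∫ e^{cu²} dν_k ≤ C_{b+c}`.
[Newman 1976, §1; Simon–Griffiths 1973, §II] [cite: Newman1976, §1] -/
theorem IsIsingLimitLaw.gaussTilt {c : ℝ} (hc : 0 ≤ c) {ν ν' : ProbabilityMeasure ℝ}
    (hν : IsIsingLimitLaw ν)
    (h : (ν' : Measure ℝ) = (∫⁻ u, ENNReal.ofReal (Real.exp (c * u ^ 2)) ∂(ν : Measure ℝ))⁻¹ •
        (ν : Measure ℝ).withDensity (fun u => ENNReal.ofReal (Real.exp (c * u ^ 2)))) :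
    IsIsingLimitLaw ν' := by
  obtain ⟨n, J, w, hJ, hw, hlim, hmom⟩ := hν
  -- `e^{(c+1)u²}` moments along the witness sequence and for the limit
  obtain ⟨C₁, hC₁⟩ := hmom (c + 1)
  have hint : ∀ k, Integrable (fun u => Real.exp ((c + 1) * u ^ 2))
      (isingMagnetizationLaw (n k) (J k) (w k) : Measure ℝ) := fun k =>
    integrable_isingMagnetizationLaw (J k) (w k) (by fun_prop : Continuous _).stronglyMeasurable
  have hexpc : Continuous fun u : ℝ => Real.exp (c * u ^ 2) := by fun_prop
  have hexp_le : ∀ u : ℝ, Real.exp (c * u ^ 2) ≤ Real.exp ((c + 1) * u ^ 2) := fun u =>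
    Real.exp_le_exp.2 (by nlinarith [sq_nonneg u])
  have hIν : Integrable (fun u => Real.exp ((c + 1) * u ^ 2)) (ν : Measure ℝ) :=
    (integrable_exp_mul_sq_of_tendsto hlim hint hC₁).1
  have hIcν : Integrable (fun u => Real.exp (c * u ^ 2)) (ν : Measure ℝ) :=
    hIν.mono' hexpc.aestronglyMeasurable (Eventually.of_forall fun u => by
      rw [Real.norm_of_nonneg (Real.exp_pos _).le]; exact hexp_le u)
  have hD1 : 1 ≤ ∫ u, Real.exp (c * u ^ 2) ∂(ν : Measure ℝ) := by
    have h1 := integral_mono (integrable_const (1 : ℝ)) hIcν fun u =>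
      Real.one_le_exp (by positivity : 0 ≤ c * u ^ 2)
    simpa using h1
  -- integrals against the tilted law `ν'`
  have hν' : ∀ f : ℝ → ℝ, ∫ u, f u ∂(ν' : Measure ℝ) =
      (∫ u, Real.exp (c * u ^ 2) * f u ∂(ν : Measure ℝ)) /
        ∫ u, Real.exp (c * u ^ 2) ∂(ν : Measure ℝ) := by
    intro f
    have hmeas : Measurable fun u => ENNReal.ofReal (Real.exp (c * u ^ 2)) :=
      hexpc.measurable.ennreal_ofReal
    rw [h, integral_smul_measure, integral_withDensity_eq_integral_toReal_smul hmeas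
      (Eventually.of_forall fun _ => ENNReal.ofReal_lt_top),
      ← ofReal_integral_eq_lintegral_ofReal hIcν
        (Eventually.of_forall fun u => (Real.exp_pos _).le),
      ENNReal.toReal_inv, ENNReal.toReal_ofReal (by linarith), smul_eq_mul, div_eq_inv_mul]
    congr 1
    refine integral_congr_ae (Eventually.of_forall fun u => ?_)
    dsimp only
    rw [ENNReal.toReal_ofReal (Real.exp_pos _).le, smul_eq_mul]
  -- the tilted finite laws: rank-one coupling shift
  have htilt : ∀ k (f : ℝ → ℝ), Continuous f →
      ∫ u, f u ∂(isingMagnetizationLaw (n k) (fun i j => J k i j + c * (w k i * w k j)) (w k) :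
          Measure ℝ) =
        (∫ u, Real.exp (c * u ^ 2) * f u ∂(isingMagnetizationLaw (n k) (J k) (w k) : Measure ℝ)) /
          ∫ u, Real.exp (c * u ^ 2) ∂(isingMagnetizationLaw (n k) (J k) (w k) : Measure ℝ) := by
    intro k f hf
    rw [integral_isingMagnetizationLaw_add_rankOne (J k) (w k) c hf.stronglyMeasurable,
      smul_eq_mul, div_eq_inv_mul]
    simp only [smul_eq_mul]
  refine ⟨n, fun k i j => J k i j + c * (w k i * w k j), w, ?_, hw, ?_, ?_⟩
  · -- ferromagnetic
    intro k i j
    exact add_nonneg (hJ k i j) (mul_nonneg hc (mul_nonneg (hw k i) (hw k j)))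
  · -- weak convergence to the tilted law
    rw [ProbabilityMeasure.tendsto_iff_forall_integral_tendsto]
    intro f
    have hfB : ∀ u, |f u| ≤ ‖f‖ := fun u => by
      simpa only [Real.norm_eq_abs] using f.norm_coe_le_norm u
    have hN := tendsto_integral_of_tendsto_of_exp_mul_sq_bound hlim hc (norm_nonneg f) hint hC₁
      (g := fun u => Real.exp (c * u ^ 2) * f u) (hexpc.mul f.continuous) fun u => by
        rw [abs_mul, abs_of_pos (Real.exp_pos _), mul_comm]
        exact mul_le_mul_of_nonneg_right (hfB u) (Real.exp_pos _).le
    have hD := tendsto_integral_of_tendsto_of_exp_mul_sq_bound hlim hc zero_le_one hint hC₁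
      (g := fun u => Real.exp (c * u ^ 2)) hexpc fun u => by
        rw [abs_of_pos (Real.exp_pos _), one_mul]
    rw [hν' f]
    refine (hN.div hD (by linarith)).congr fun k => ?_
    exact (htilt k f f.continuous).symm
  · -- uniform Gaussian-exponential moments
    intro b
    obtain ⟨Cb, hCb⟩ := hmom (b + c)
    refine ⟨Cb, fun k => ?_⟩
    rw [integral_exp_mul_sq_isingMagnetizationLaw_add_rankOne]
    have hDk1 : 1 ≤ ∫ u, Real.exp (c * u ^ 2) ∂(isingMagnetizationLaw (n k) (J k) (w k) : Measure ℝ) := by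
      have h1 := integral_mono (integrable_const (1 : ℝ))
        (integrable_isingMagnetizationLaw (J k) (w k) hexpc.stronglyMeasurable)
        fun u => Real.one_le_exp (by positivity : 0 ≤ c * u ^ 2)
      simpa using h1
    have hNk0 : 0 ≤ ∫ u, Real.exp ((b + c) * u ^ 2)
        ∂(isingMagnetizationLaw (n k) (J k) (w k) : Measure ℝ) :=
      integral_nonneg fun u => (Real.exp_pos _).le
    exact (div_le_self hNk0 hDk1).trans (hCb k)

end Literature.Probability.LatticeModels

end
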